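import Mathlib
import Summits.AnomalousDissipation.AnomalousDissipation.Theorems.DyadicWallCascadeDyadicRealisationFluxSignTools
import Summits.AnomalousDissipation.AnomalousDissipation.Theorems.DyadicWallCascadeDyadicRealisationFluxSignTools2
import Summits.AnomalousDissipation.AnomalousDissipation.Theorems.DyadicWallCascadeDyadicRealisationFluxSignTools4
import Summits.AnomalousDissipation.AnomalousDissipation.Theorems.DyadicWallCascadeDyadicRealisationZeroStressTools
import HarnessLib

/-!
# The tested horizontal momentum balance at one dyadic scale

Second tools file for `stub_zeroStress` (crux `DyadicRealisation`, line Sketch): for a bounded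
smooth mirror-symmetric solution `(W, P)` of the clause-form steady Navier–Stokes system on `ℝ³`
and the product test function `χ(Y₀)χ(Y₁)θ(Y₂)` (`χ' = S'(·+R) − S'(·−R)`, `θ' = ρ(−·) − ρ`),
the scaled tested momentum identity in a horizontal direction `eᵢ` (`i ≠ 2`) gives
`|2∫ χχρ W₂(λ·)Wᵢ(λ·)| ≤ λ⁻¹A + 4(C'² + C') ∫χ ∫θ` (`zeroStress_scale_ineq`; the lower vertical
edge is folded onto the upper one by the mirror symmetry, `Wᵢ` even, `W₂` odd); and the
thin-layer limit `zeroStress_layer_limit`.  Ends with the registered tools stub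
`stub_zeroStressTools2`.  All folklore calculus.
-/
open MeasureTheory Set Filter Topology Function

set_option linter.dupNamespace false

namespace Summit.AnomalousDissipation.AnomalousDissipation.Theorems

/-- **Horizontal edge terms are `O(R⁰)` relative to the plateau.**  For `S' ≥ 0` with `∫S' = 1`,
cut-offs `0 ≤ χ, θ ≤ 1` and a continuous density `u` with `|u| ≤ D`,
`|∫ (S'(Y₀+R) − S'(Y₀−R)) χ(Y₁) θ(Y₂) u| ≤ 2 D ∫χ ∫θ`, and the same with the roles of `Y₀, Y₁`
exchanged. [folklore] -/
theorem zeroStress_horiz_bound (S1 χ θ : ℝ → ℝ) (R D : ℝ) (u : EuclideanSpace ℝ (Fin 3) → ℝ)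
    (hS1c : Continuous S1) (hS1cs : HasCompactSupport S1) (hS1nn : ∀ t, 0 ≤ S1 t)
    (hS1i : ∫ t, S1 t = 1) (hχc : Continuous χ) (hχcs : HasCompactSupport χ)
    (hχ01 : ∀ t, 0 ≤ χ t ∧ χ t ≤ 1) (hθc : Continuous θ) (hθcs : HasCompactSupport θ)
    (hθ01 : ∀ s, 0 ≤ θ s ∧ θ s ≤ 1) (hu : ∀ Y, |u Y| ≤ D) :
    |∫ Y : EuclideanSpace ℝ (Fin 3), (S1 (Y 0 + R) - S1 (Y 0 - R)) * χ (Y 1) * θ (Y 2) * u Y| ≤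
        2 * (∫ t, χ t) * (∫ s, θ s) * D ∧
      |∫ Y : EuclideanSpace ℝ (Fin 3), χ (Y 0) * (S1 (Y 1 + R) - S1 (Y 1 - R)) * θ (Y 2) * u Y| ≤
        2 * (∫ t, χ t) * (∫ s, θ s) * D := by
  obtain ⟨rS, hrS⟩ := fluxSign_exists_abs_le_of_hasCompactSupport hS1cs
  have hχr := fluxSign_exists_abs_le_of_hasCompactSupport hχcs
  have hθr := fluxSign_exists_abs_le_of_hasCompactSupport hθcs
  have hshift : ∀ t, S1 (t - R) ≠ 0 ∨ S1 (t + R) ≠ 0 → |t| ≤ rS + |R| := by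
    rintro t (h | h)
    · have h' := abs_add_le (t - R) R
      rw [sub_add_cancel] at h'; linarith [hrS _ h]
    · have h' := abs_add_le (t + R) (-R)
      rw [abs_neg, add_neg_cancel_right] at h'; linarith [hrS _ h]
  have hSpr : ∃ r : ℝ, ∀ t, S1 (t + R) + S1 (t - R) ≠ 0 → |t| ≤ r :=
    ⟨rS + |R|, fun t ht => hshift t (by
      by_contra h; push Not at h; exact ht (by rw [h.1, h.2, add_zero]))⟩
  have hSpc : Continuous fun t => S1 (t + R) + S1 (t - R) :=
    (hS1c.comp (continuous_add_const R)).add (hS1c.comp (continuous_sub_right R))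
  have hS1sum : ∫ t, (S1 (t + R) + S1 (t - R)) = 2 := by
    have i1 : Integrable (fun t => S1 (t + R)) :=
      (hS1c.comp (continuous_add_const R)).integrable_of_hasCompactSupport
        (hS1cs.comp_homeomorph (Homeomorph.addRight R))
    have i2 : Integrable (fun t => S1 (t - R)) :=
      (hS1c.comp (continuous_sub_right R)).integrable_of_hasCompactSupport
        (hS1cs.comp_homeomorph (Homeomorph.subRight R))
    rw [integral_add i1 i2, integral_add_right_eq_self (μ := (volume : Measure ℝ)) S1 R,
      integral_sub_right_eq_self (μ := (volume : Measure ℝ)) S1 R, hS1i]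
    norm_num
  have hD : 0 ≤ D := (abs_nonneg _).trans (hu 0)
  have hS1abs : ∀ t, |S1 (t + R) - S1 (t - R)| ≤ S1 (t + R) + S1 (t - R) := fun t =>
    (abs_sub _ _).trans (by rw [abs_of_nonneg (hS1nn _), abs_of_nonneg (hS1nn _)])
  constructor
  · have hg := fluxSign_integrable_prod3 (fun t => S1 (t + R) + S1 (t - R)) χ θ (fun _ => D)
      hSpc hχc hθc continuous_const hSpr hχr hθr
    refine (Real.norm_eq_abs _).symm.le.trans ((norm_integral_le_of_norm_le hg
      (Eventually.of_forall fun Y => ?_)).trans (le_of_eq ?_))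
    · rw [Real.norm_eq_abs, abs_mul, abs_mul, abs_mul, abs_of_nonneg (hχ01 _).1,
        abs_of_nonneg (hθ01 _).1]
      refine mul_le_mul (mul_le_mul_of_nonneg_right (mul_le_mul_of_nonneg_right
        (hS1abs _) (hχ01 _).1) (hθ01 _).1) (hu Y) (abs_nonneg _) ?_
      exact mul_nonneg (mul_nonneg (add_nonneg (hS1nn _) (hS1nn _)) (hχ01 _).1) (hθ01 _).1
    · rw [integral_mul_const, fluxSign_integral_prod3 (fun t => S1 (t + R) + S1 (t - R)) χ θ,
        hS1sum]
  · have hg := fluxSign_integrable_prod3 χ (fun t => S1 (t + R) + S1 (t - R)) θ (fun _ => D)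
      hχc hSpc hθc continuous_const hχr hSpr hθr
    refine (Real.norm_eq_abs _).symm.le.trans ((norm_integral_le_of_norm_le hg
      (Eventually.of_forall fun Y => ?_)).trans (le_of_eq ?_))
    · rw [Real.norm_eq_abs, abs_mul, abs_mul, abs_mul, abs_of_nonneg (hχ01 _).1,
        abs_of_nonneg (hθ01 _).1]
      refine mul_le_mul (mul_le_mul_of_nonneg_right (mul_le_mul_of_nonneg_left
        (hS1abs _) (hχ01 _).1) (hθ01 _).1) (hu Y) (abs_nonneg _) ?_
      exact mul_nonneg (mul_nonneg (hχ01 _).1 (add_nonneg (hS1nn _) (hS1nn _))) (hθ01 _).1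
    · rw [integral_mul_const, fluxSign_integral_prod3 χ (fun t => S1 (t + R) + S1 (t - R)) θ,
        hS1sum]
      ring

/-- **The tested horizontal momentum balance at one scale.**  See the module docstring: for
`(W, P)` bounded, smooth, mirror-symmetric and solving the clause-form steady system, a
horizontal direction `eᵢ` (`i ≠ 2`), and profiles `S' ≥ 0` (`∫S' = 1`), `χ ∈ C^∞_c` with
`0 ≤ χ ≤ 1`, `χ' = S'(·+R) − S'(·−R)`, `θ ∈ C^∞_c` with `0 ≤ θ ≤ 1`, `θ' = ρ(−·) − ρ`, there is
`A` with `|2∫ χ(Y₀)χ(Y₁)ρ(Y₂) W₂(λY)Wᵢ(λY) dY| ≤ λ⁻¹A + 4(C'² + C') ∫χ ∫θ` for all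
`λ > 0`. [folklore] -/
theorem zeroStress_scale_ineq
    (W : EuclideanSpace ℝ (Fin 3) → EuclideanSpace ℝ (Fin 3)) (P : EuclideanSpace ℝ (Fin 3) → ℝ)
    (C' : ℝ) (S1 χ ρ θ : ℝ → ℝ) (R : ℝ) (i : Fin 3) (hi : i ≠ 2)
    (hW : ContDiff ℝ ((⊤ : ℕ∞) : WithTop ℕ∞) W) (hP : ContDiff ℝ ((⊤ : ℕ∞) : WithTop ℕ∞) P)
    (hdiv : ∀ X, ∑ i : Fin 3, (fderiv ℝ W X (EuclideanSpace.single i (1 : ℝ))) i = 0)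
    (hNS : ∀ X, (fderiv ℝ W X) (W X) + gradient P X =
      ∑ i : Fin 3, fderiv ℝ (fun Y => fderiv ℝ W Y (EuclideanSpace.single i (1 : ℝ))) X
        (EuclideanSpace.single i (1 : ℝ)))
    (hWb : ∀ X, ‖W X‖ ≤ C' ∧ |P X| ≤ C')
    (hmir : ∀ X : EuclideanSpace ℝ (Fin 3),
      W (X - (2 * X 2) • EuclideanSpace.single 2 (1 : ℝ)) =
          W X - (2 * (W X) 2) • EuclideanSpace.single 2 (1 : ℝ) ∧
        P (X - (2 * X 2) • EuclideanSpace.single 2 (1 : ℝ)) = P X)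
    (hS1c : Continuous S1) (hS1cs : HasCompactSupport S1) (hS1nn : ∀ t, 0 ≤ S1 t)
    (hS1i : ∫ t, S1 t = 1)
    (hχ : ContDiff ℝ ((⊤ : ℕ∞) : WithTop ℕ∞) χ) (hχcs : HasCompactSupport χ)
    (hχ01 : ∀ t, 0 ≤ χ t ∧ χ t ≤ 1) (hχd : ∀ t, deriv χ t = S1 (t + R) - S1 (t - R))
    (hρc : Continuous ρ) (hρcs : HasCompactSupport ρ)
    (hθ : ContDiff ℝ ((⊤ : ℕ∞) : WithTop ℕ∞) θ) (hθcs : HasCompactSupport θ)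
    (hθ01 : ∀ s, 0 ≤ θ s ∧ θ s ≤ 1) (hθd : ∀ s, deriv θ s = ρ (-s) - ρ s) :
    ∃ A : ℝ, ∀ lam : ℝ, 0 < lam →
      |2 * ∫ Y : EuclideanSpace ℝ (Fin 3), χ (Y 0) * χ (Y 1) * ρ (Y 2) *
          ((W (lam • Y)) 2 * (W (lam • Y)) i)| ≤
        lam⁻¹ * A + 4 * (C' ^ 2 + C') * ((∫ t, χ t) * ∫ s, θ s) := by
  obtain ⟨hφs, hφd, hφcs'⟩ := fluxSign_testfun χ θ hχ hθ
  have hφcs := hφcs' hχcs hθcs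
  obtain ⟨A, hA⟩ := zeroStress_momentum_scaled W P _ C' i hW hP hdiv hNS (fun X => (hWb X).1)
    (contDiff_infty.1 hφs 2) hφcs
  refine ⟨A, fun lam hlam => ?_⟩
  have key := hA lam hlam
  set a : EuclideanSpace ℝ (Fin 3) := EuclideanSpace.single i (1 : ℝ) with ha
  have ha2 : a 2 = 0 := by
    rw [ha, PiLp.single_apply, if_neg (Ne.symm hi)]
  have haj : ∀ j : Fin 3, |a j| ≤ 1 := fun j => by
    rw [ha, PiLp.single_apply]
    split_ifs <;> simp
  -- continuity and support facts
  have hWc : Continuous W := hW.continuous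
  have hPc : Continuous P := hP.continuous
  have hsc : Continuous fun Y : EuclideanSpace ℝ (Fin 3) => lam • Y := continuous_const_smul lam
  have hwc : Continuous fun Y : EuclideanSpace ℝ (Fin 3) => W (lam • Y) := hWc.comp hsc
  have hpc : Continuous fun Y : EuclideanSpace ℝ (Fin 3) => P (lam • Y) := hPc.comp hsc
  have hwic : ∀ j : Fin 3, Continuous fun Y : EuclideanSpace ℝ (Fin 3) => (W (lam • Y)) j :=
    fun j => (PiLp.continuous_apply 2 _ j).comp hwc
  have hχc : Continuous χ := hχ.continuous
  have hθc : Continuous θ := hθ.continuous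
  obtain ⟨rS, hrS⟩ := fluxSign_exists_abs_le_of_hasCompactSupport hS1cs
  have hχr := fluxSign_exists_abs_le_of_hasCompactSupport hχcs
  have hθr := fluxSign_exists_abs_le_of_hasCompactSupport hθcs
  have hρr := fluxSign_exists_abs_le_of_hasCompactSupport hρcs
  have hρr' : ∃ r : ℝ, ∀ t, ρ (-t) ≠ 0 → |t| ≤ r := by
    obtain ⟨r, hr⟩ := hρr; exact ⟨r, fun t ht => by simpa using hr _ ht⟩
  have hSr : ∃ r : ℝ, ∀ t, S1 (t + R) - S1 (t - R) ≠ 0 → |t| ≤ r := by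
    refine ⟨rS + |R|, fun t ht => ?_⟩
    by_cases h1 : S1 (t - R) ≠ 0
    · have h' := abs_add_le (t - R) R
      rw [sub_add_cancel] at h'; linarith [hrS _ h1]
    · push Not at h1
      have h' := abs_add_le (t + R) (-R)
      rw [abs_neg, add_neg_cancel_right] at h'
      linarith [hrS _ (fun h => ht (by rw [h, h1, sub_zero]))]
  have hSdc : Continuous fun t => S1 (t + R) - S1 (t - R) :=
    (hS1c.comp (continuous_add_const R)).sub (hS1c.comp (continuous_sub_right R))
  -- pointwise bounds on the densities
  have hC'0 : 0 ≤ C' := (norm_nonneg _).trans (hWb 0).1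
  have hcoord : ∀ (j : Fin 3) (Y : EuclideanSpace ℝ (Fin 3)), |(W (lam • Y)) j| ≤ C' :=
    fun j Y => ((Real.norm_eq_abs _).symm.le.trans (PiLp.norm_apply_le (W (lam • Y)) j)).trans
      (hWb _).1
  have hdens : ∀ (j : Fin 3) (Y : EuclideanSpace ℝ (Fin 3)),
      |(W (lam • Y)) j * (W (lam • Y)) i| ≤ C' ^ 2 := fun j Y => by
    rw [abs_mul, sq]
    exact mul_le_mul (hcoord j Y) (hcoord i Y) (abs_nonneg _) hC'0
  have hdensP : ∀ (j : Fin 3) (Y : EuclideanSpace ℝ (Fin 3)), |a j * P (lam • Y)| ≤ C' :=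
    fun j Y => by
    rw [abs_mul]
    exact (mul_le_mul (haj j) (hWb _).2 (abs_nonneg _) zero_le_one).trans_eq (one_mul _)
  -- expansion of the two tested terms
  have hexp1 : ∀ Y : EuclideanSpace ℝ (Fin 3),
      (W (lam • Y)) i *
          fderiv ℝ (fun Y : EuclideanSpace ℝ (Fin 3) => χ (Y 0) * χ (Y 1) * θ (Y 2)) Y
            (W (lam • Y)) =
        (S1 (Y 0 + R) - S1 (Y 0 - R)) * χ (Y 1) * θ (Y 2) *
            ((W (lam • Y)) 0 * (W (lam • Y)) i) +
          χ (Y 0) * (S1 (Y 1 + R) - S1 (Y 1 - R)) * θ (Y 2) *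
            ((W (lam • Y)) 1 * (W (lam • Y)) i) +
          (χ (Y 0) * χ (Y 1) * ρ (-(Y 2)) * ((W (lam • Y)) 2 * (W (lam • Y)) i) -
            χ (Y 0) * χ (Y 1) * ρ (Y 2) * ((W (lam • Y)) 2 * (W (lam • Y)) i)) := by
    intro Y
    rw [hφd, hχd, hχd, hθd]
    ring
  have hexp2 : ∀ Y : EuclideanSpace ℝ (Fin 3),
      P (lam • Y) * fderiv ℝ (fun Y : EuclideanSpace ℝ (Fin 3) => χ (Y 0) * χ (Y 1) * θ (Y 2)) Y a =
        (S1 (Y 0 + R) - S1 (Y 0 - R)) * χ (Y 1) * θ (Y 2) * (a 0 * P (lam • Y)) +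
          χ (Y 0) * (S1 (Y 1 + R) - S1 (Y 1 - R)) * θ (Y 2) * (a 1 * P (lam • Y)) := by
    intro Y
    rw [hφd, hχd, hχd, ha2]
    ring
  -- integrability of the six pieces
  have hI0 := fluxSign_integrable_prod3 (fun t => S1 (t + R) - S1 (t - R)) χ θ
    (fun Y => (W (lam • Y)) 0 * (W (lam • Y)) i) hSdc hχc hθc ((hwic 0).mul (hwic i)) hSr hχr hθr
  have hI1 := fluxSign_integrable_prod3 χ (fun t => S1 (t + R) - S1 (t - R)) θ
    (fun Y => (W (lam • Y)) 1 * (W (lam • Y)) i) hχc hSdc hθc ((hwic 1).mul (hwic i)) hχr hSr hθr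
  have hI2a := fluxSign_integrable_prod3 χ χ (fun s => ρ (-s))
    (fun Y => (W (lam • Y)) 2 * (W (lam • Y)) i) hχc hχc (hρc.comp continuous_neg)
    ((hwic 2).mul (hwic i)) hχr hχr hρr'
  have hI2b := fluxSign_integrable_prod3 χ χ ρ
    (fun Y => (W (lam • Y)) 2 * (W (lam • Y)) i) hχc hχc hρc ((hwic 2).mul (hwic i)) hχr hχr hρr
  have hJ0 := fluxSign_integrable_prod3 (fun t => S1 (t + R) - S1 (t - R)) χ θ
    (fun Y => a 0 * P (lam • Y)) hSdc hχc hθc (continuous_const.mul hpc) hSr hχr hθr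
  have hJ1 := fluxSign_integrable_prod3 χ (fun t => S1 (t + R) - S1 (t - R)) θ
    (fun Y => a 1 * P (lam • Y)) hχc hSdc hθc (continuous_const.mul hpc) hχr hSr hθr
  simp_rw [hexp1, hexp2] at key
  rw [integral_add (hI0.fun_add hI1) (hI2a.sub' hI2b), integral_add hI0 hI1,
    integral_sub hI2a hI2b, integral_add hJ0 hJ1] at key
  -- the reflected vertical edge
  have hrefl : ∫ Y : EuclideanSpace ℝ (Fin 3), χ (Y 0) * χ (Y 1) * ρ (-(Y 2)) *
      ((W (lam • Y)) 2 * (W (lam • Y)) i) =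
      -∫ Y : EuclideanSpace ℝ (Fin 3), χ (Y 0) * χ (Y 1) * ρ (Y 2) *
        ((W (lam • Y)) 2 * (W (lam • Y)) i) := by
    rw [← integral_neg, ← fluxSign_integral_reflect]
    refine integral_congr_ae (Eventually.of_forall fun Y => ?_)
    simp only
    rw [fluxSign_smul_reflect, (hmir _).1]
    have c0 : (Y - (2 * Y 2) • EuclideanSpace.single (2 : Fin 3) (1 : ℝ)) 0 = Y 0 := by simp
    have c1 : (Y - (2 * Y 2) • EuclideanSpace.single (2 : Fin 3) (1 : ℝ)) 1 = Y 1 := by simp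
    have c2 : (Y - (2 * Y 2) • EuclideanSpace.single (2 : Fin 3) (1 : ℝ)) 2 = -(Y 2) := by
      simp; ring
    have d2 : (W (lam • Y) - (2 * (W (lam • Y)) 2) • EuclideanSpace.single (2 : Fin 3) (1 : ℝ)) 2 =
        -((W (lam • Y)) 2) := by simp; ring
    have di : (W (lam • Y) - (2 * (W (lam • Y)) 2) • EuclideanSpace.single (2 : Fin 3) (1 : ℝ)) i =
        (W (lam • Y)) i := by
      rw [PiLp.sub_apply, PiLp.smul_apply, PiLp.single_apply, if_neg hi, smul_zero,
        sub_zero]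
    rw [c0, c1, c2, d2, di, neg_neg]
    ring
  rw [hrefl] at key
  -- the four horizontal terms
  have hH0 := (zeroStress_horiz_bound S1 χ θ R (C' ^ 2)
    (fun Y => (W (lam • Y)) 0 * (W (lam • Y)) i) hS1c hS1cs hS1nn hS1i hχc hχcs hχ01 hθc hθcs
    hθ01 (hdens 0)).1
  have hH1 := (zeroStress_horiz_bound S1 χ θ R (C' ^ 2)
    (fun Y => (W (lam • Y)) 1 * (W (lam • Y)) i) hS1c hS1cs hS1nn hS1i hχc hχcs hχ01 hθc hθcs
    hθ01 (hdens 1)).2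
  have hP0 := (zeroStress_horiz_bound S1 χ θ R C' (fun Y => a 0 * P (lam • Y)) hS1c hS1cs hS1nn
    hS1i hχc hχcs hχ01 hθc hθcs hθ01 (hdensP 0)).1
  have hP1 := (zeroStress_horiz_bound S1 χ θ R C' (fun Y => a 1 * P (lam • Y)) hS1c hS1cs hS1nn
    hS1i hχc hχcs hχ01 hθc hθcs hθ01 (hdensP 1)).2
  have k := abs_le.1 key
  have a0 := abs_le.1 hH0; have a1 := abs_le.1 hH1; have b0 := abs_le.1 hP0; have b1 := abs_le.1 hP1
  rw [abs_le]
  constructor <;> nlinarith [k.1, k.2, a0.1, a0.2, a1.1, a1.2, b0.1, b0.2, b1.1, b1.2]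

/-- **Thin-layer limit.**  Let `κ` be the two-cell partition-of-unity profile, `ρ_b ≥ 0`
(`b ≥ 1`) vertical weights supported in `1 < s < 1 + 1/b` with `∫ρ_b = 1`, and `Φ` a continuous
function on `ℝ³`, `1`-periodic in `Y₀, Y₁` on the band `1 ≤ Y₂ ≤ 2`.  If the cell averages
`∫ κ(Y₀)κ(Y₁)ρ_b(Y₂) Φ` vanish for every `b ≥ 1`, then `∫_{[0,1]²} Φ(q, 1) dq = 0` (uniform
continuity of `Φ` near the plane `Y₂ = 1` and the cell-averaging identity
`fluxSign_lower_eval`). [folklore] -/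
theorem zeroStress_layer_limit (κ : ℝ → ℝ) (ρ : ℝ → ℝ → ℝ) (Φ : EuclideanSpace ℝ (Fin 3) → ℝ)
    (hκc : Continuous κ) (hκnn : ∀ t, 0 ≤ κ t) (hκ0 : ∀ t, t ≤ 0 → κ t = 0)
    (hκ2 : ∀ t, 2 ≤ t → κ t = 0) (hκ1 : ∀ t, 0 ≤ t → t ≤ 1 → κ t + κ (t + 1) = 1)
    (hρ : ∀ b : ℝ, 1 ≤ b → Continuous (ρ b) ∧ (∀ s, 0 ≤ ρ b s) ∧
      (∀ s, ρ b s ≠ 0 → 1 < s ∧ s < 1 + b⁻¹) ∧ ∫ s, ρ b s = 1)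
    (hΦc : Continuous Φ)
    (hΦper : ∀ Y : EuclideanSpace ℝ (Fin 3), 1 ≤ Y 2 → Y 2 ≤ 2 →
      Φ (Y + EuclideanSpace.single 0 (1 : ℝ)) = Φ Y ∧ Φ (Y + EuclideanSpace.single 1 (1 : ℝ)) = Φ Y)
    (hJ : ∀ b : ℝ, 1 ≤ b →
      ∫ Y : EuclideanSpace ℝ (Fin 3), κ (Y 0) * κ (Y 1) * (ρ b (Y 2) * Φ Y) = 0) :
    ∫ q in Set.Icc (0 : ℝ) 1 ×ˢ Set.Icc (0 : ℝ) 1, Φ !₂[q.1, q.2, (1 : ℝ)] = 0 := by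
  -- the trace of `Φ` on the plane `Y₂ = 1`
  set h2 : ℝ × ℝ → ℝ := fun q => Φ !₂[q.1, q.2, (1 : ℝ)] with hh2
  have hpt : Continuous fun q : ℝ × ℝ => (!₂[q.1, q.2, (1 : ℝ)] : EuclideanSpace ℝ (Fin 3)) := by
    fun_prop
  have hh2c : Continuous h2 := hΦc.comp hpt
  have hpt2 : ∀ a c : ℝ, (!₂[a, c, (1 : ℝ)] : EuclideanSpace ℝ (Fin 3)) 2 = 1 := by
    intro a c; simp
  have hline0 : ∀ a c : ℝ, (!₂[a + 1, c, (1 : ℝ)] : EuclideanSpace ℝ (Fin 3)) =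
      !₂[a, c, (1 : ℝ)] + EuclideanSpace.single 0 (1 : ℝ) := by
    intro a c; ext j; fin_cases j <;> simp
  have hline1 : ∀ a c : ℝ, (!₂[a, c + 1, (1 : ℝ)] : EuclideanSpace ℝ (Fin 3)) =
      !₂[a, c, (1 : ℝ)] + EuclideanSpace.single 1 (1 : ℝ) := by
    intro a c; ext j; fin_cases j <;> simp
  have hh2per1 : ∀ q : ℝ × ℝ, h2 (q.1 + 1, q.2) = h2 q := fun q => by
    simp only [hh2]
    rw [hline0, (hΦper _ (by rw [hpt2]) (by rw [hpt2]; norm_num)).1]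
  have hh2per2 : ∀ q : ℝ × ℝ, h2 (q.1, q.2 + 1) = h2 q := fun q => by
    simp only [hh2]
    rw [hline1, (hΦper _ (by rw [hpt2]) (by rw [hpt2]; norm_num)).2]
  have hκr : ∃ r : ℝ, ∀ t, κ t ≠ 0 → |t| ≤ r :=
    ⟨2, fun t ht => abs_le.2 ⟨by by_contra h'; exact ht (hκ0 t (by linarith)),
      by by_contra h'; exact ht (hκ2 t (by linarith))⟩⟩
  have hκi : ∫ t, κ t = 1 := by
    have := fluxSign_cell_average_one κ (fun _ => 1) hκc continuous_const hκ0 hκ2 hκ1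
      (fun _ => rfl)
    simpa using this
  -- `|τ| ≤ ε` for every `ε > 0`
  show (∫ q in Set.Icc (0 : ℝ) 1 ×ˢ Set.Icc (0 : ℝ) 1, h2 q) = 0
  refine abs_nonpos_iff.1 (le_of_forall_pos_le_add fun ε hε => ?_)
  rw [zero_add]
  obtain ⟨δ, hδ, hUC⟩ := fluxSign_unif_cont Φ hΦc ε hε
  set b : ℝ := max 1 δ⁻¹ with hb
  have hb1 : 1 ≤ b := le_max_left _ _
  have hbδ : b⁻¹ ≤ δ := inv_le_of_inv_le₀ hδ (le_max_right _ _)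
  obtain ⟨hρc, hρnn, hρsupp, hρi⟩ := hρ b hb1
  have hρr : ∃ r : ℝ, ∀ t, ρ b t ≠ 0 → |t| ≤ r :=
    ⟨2, fun t ht => abs_le.2 ⟨by linarith [(hρsupp t ht).1], by
      linarith [(hρsupp t ht).2, inv_le_one_of_one_le₀ hb1]⟩⟩
  have hlow := fluxSign_lower_eval κ (ρ b) h2 0 hκc hκ0 hκ2 hκ1 hh2c hh2per1 hh2per2 hρi
  rw [sub_zero] at hlow
  have hJb := hJ b hb1
  -- integrability
  have hJint : Integrable fun Y : EuclideanSpace ℝ (Fin 3) =>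
      κ (Y 0) * κ (Y 1) * (ρ b (Y 2) * Φ Y) :=
    (fluxSign_integrable_prod3 κ κ (ρ b) Φ hκc hκc hρc hΦc hκr hκr hρr).congr
      (Eventually.of_forall fun Y => by simp only; ring)
  have hRint : Integrable fun Y : EuclideanSpace ℝ (Fin 3) =>
      κ (Y 0) * κ (Y 1) * ρ b (Y 2) * (h2 (Y 0, Y 1) - 0) :=
    fluxSign_integrable_prod3 κ κ (ρ b) (fun Y => h2 (Y 0, Y 1) - 0) hκc hκc hρc
      ((hh2c.comp ((PiLp.continuous_apply 2 _ 0).prodMk (PiLp.continuous_apply 2 _ 1))).sub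
        continuous_const) hκr hκr hρr
  have hBint : Integrable fun Y : EuclideanSpace ℝ (Fin 3) =>
      κ (Y 0) * κ (Y 1) * ρ b (Y 2) * ε :=
    fluxSign_integrable_prod3 κ κ (ρ b) (fun _ => ε) hκc hκc hρc continuous_const hκr hκr hρr
  -- pointwise comparison near the plane
  have hptw : ∀ Y : EuclideanSpace ℝ (Fin 3),
      ‖κ (Y 0) * κ (Y 1) * ρ b (Y 2) * (h2 (Y 0, Y 1) - 0) - κ (Y 0) * κ (Y 1) * (ρ b (Y 2) * Φ Y)‖
        ≤ κ (Y 0) * κ (Y 1) * ρ b (Y 2) * ε := by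
    intro Y
    rw [Real.norm_eq_abs, sub_zero,
      show κ (Y 0) * κ (Y 1) * ρ b (Y 2) * h2 (Y 0, Y 1) - κ (Y 0) * κ (Y 1) * (ρ b (Y 2) * Φ Y) =
        κ (Y 0) * κ (Y 1) * ρ b (Y 2) * (h2 (Y 0, Y 1) - Φ Y) by ring, abs_mul]
    have hw : 0 ≤ κ (Y 0) * κ (Y 1) * ρ b (Y 2) :=
      mul_nonneg (mul_nonneg (hκnn _) (hκnn _)) (hρnn _)
    rw [abs_of_nonneg hw]
    by_cases hz : κ (Y 0) * κ (Y 1) * ρ b (Y 2) = 0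
    · rw [hz, zero_mul, zero_mul]
    · refine mul_le_mul_of_nonneg_left ?_ hw
      have hk0 : κ (Y 0) ≠ 0 := fun h0 => hz (by rw [h0]; ring)
      have hk1 : κ (Y 1) ≠ 0 := fun h0 => hz (by rw [h0]; ring)
      have hr2 : ρ b (Y 2) ≠ 0 := fun h0 => hz (by rw [h0]; ring)
      have hY0 : 0 ≤ Y 0 ∧ Y 0 ≤ 2 :=
        ⟨by by_contra h'; exact hk0 (hκ0 _ (by linarith)),
          by by_contra h'; exact hk0 (hκ2 _ (by linarith))⟩
      have hY1 : 0 ≤ Y 1 ∧ Y 1 ≤ 2 :=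
        ⟨by by_contra h'; exact hk1 (hκ0 _ (by linarith)),
          by by_contra h'; exact hk1 (hκ2 _ (by linarith))⟩
      have hY2 : 1 < Y 2 ∧ Y 2 < 1 + b⁻¹ := hρsupp _ hr2
      have hbinv1 : b⁻¹ ≤ 1 := inv_le_one_of_one_le₀ hb1
      set Y' : EuclideanSpace ℝ (Fin 3) := !₂[Y 0, Y 1, (1 : ℝ)] with hY'
      have hd : Y' - Y = (1 - Y 2) • EuclideanSpace.single 2 (1 : ℝ) := by
        ext j; fin_cases j <;> simp [hY']
      have hnY : ‖Y‖ ≤ 10 := (fluxSign_norm_le_coord Y).trans (by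
        rw [abs_of_nonneg hY0.1, abs_of_nonneg hY1.1, abs_of_pos (by linarith)]; linarith)
      have hnY' : ‖Y'‖ ≤ 10 := (fluxSign_norm_le_coord Y').trans (by
        simp only [hY']
        simp only [Matrix.cons_val_zero, Matrix.cons_val_one, Matrix.cons_val, abs_one]
        rw [abs_of_nonneg hY0.1, abs_of_nonneg hY1.1]; linarith)
      have hdist : ‖Y' - Y‖ ≤ δ := by
        have hn1 : ‖(EuclideanSpace.single (2 : Fin 3) (1 : ℝ) : EuclideanSpace ℝ (Fin 3))‖ = 1 := by
          simp
        rw [hd, norm_smul, hn1, mul_one, Real.norm_eq_abs, abs_of_neg (by linarith)]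
        linarith
      have := hUC Y' Y hnY' hnY hdist
      simpa only [hh2] using this
  have hdiff := norm_integral_le_of_norm_le hBint (Eventually.of_forall hptw)
  rw [integral_sub hRint hJint, hlow, hJb, sub_zero, Real.norm_eq_abs] at hdiff
  refine hdiff.trans (le_of_eq ?_)
  rw [integral_mul_const, fluxSign_integral_prod3 κ κ (ρ b), hκi, hρi]
  ring

/-- Registered tools stub of `stub_zeroStress` (line Sketch of crux `DyadicRealisation`): the
conjunction of the lemmas of this file. [folklore] -/
theorem stub_zeroStressTools2 :
    (∀ (S1 χ θ : ℝ → ℝ) (R D : ℝ) (u : EuclideanSpace ℝ (Fin 3) → ℝ), Continuous S1 →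
    HasCompactSupport S1 → (∀ t, 0 ≤ S1 t) → (∫ t, S1 t = 1) → Continuous χ → HasCompactSupport χ →
    (∀ t, 0 ≤ χ t ∧ χ t ≤ 1) → Continuous θ → HasCompactSupport θ → (∀ s, 0 ≤ θ s ∧ θ s ≤ 1) → (∀ Y,
    |u Y| ≤ D) → |∫ Y : EuclideanSpace ℝ (Fin 3), (S1 (Y 0 + R) - S1 (Y 0 - R)) * χ (Y 1) * θ (Y 2)
    * u Y| ≤ 2 * (∫ t, χ t) * (∫ s, θ s) * D ∧ |∫ Y : EuclideanSpace ℝ (Fin 3), χ (Y 0) * (S1 (Y 1 +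
    R) - S1 (Y 1 - R)) * θ (Y 2) * u Y| ≤ 2 * (∫ t, χ t) * (∫ s, θ s) * D) ∧ (∀ (W : EuclideanSpace
    ℝ (Fin 3) → EuclideanSpace ℝ (Fin 3)) (P : EuclideanSpace ℝ (Fin 3) → ℝ) (C' : ℝ) (S1 χ ρ θ : ℝ
    → ℝ) (R : ℝ) (i : Fin 3), i ≠ 2 → ContDiff ℝ ((⊤ : ℕ∞) : WithTop ℕ∞) W → ContDiff ℝ ((⊤ : ℕ∞) :
    WithTop ℕ∞) P → (∀ X : EuclideanSpace ℝ (Fin 3), ∑ i : Fin 3, (fderiv ℝ W X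
    (EuclideanSpace.single i (1 : ℝ))) i = 0) → (∀ X : EuclideanSpace ℝ (Fin 3), (fderiv ℝ W X) (W
    X) + gradient P X = ∑ i : Fin 3, fderiv ℝ (fun Y => fderiv ℝ W Y (EuclideanSpace.single i (1 :
    ℝ))) X (EuclideanSpace.single i (1 : ℝ))) → (∀ X : EuclideanSpace ℝ (Fin 3), ‖W X‖ ≤ C' ∧ |P X|
    ≤ C') → (∀ X : EuclideanSpace ℝ (Fin 3), W (X - (2 * X 2) • EuclideanSpace.single 2 (1 : ℝ)) = W
    X - (2 * (W X) 2) • EuclideanSpace.single 2 (1 : ℝ) ∧ P (X - (2 * X 2) • EuclideanSpace.single 2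
    (1 : ℝ)) = P X) → Continuous S1 → HasCompactSupport S1 → (∀ t, 0 ≤ S1 t) → (∫ t, S1 t = 1) →
    ContDiff ℝ ((⊤ : ℕ∞) : WithTop ℕ∞) χ → HasCompactSupport χ → (∀ t, 0 ≤ χ t ∧ χ t ≤ 1) → (∀ t,
    deriv χ t = S1 (t + R) - S1 (t - R)) → Continuous ρ → HasCompactSupport ρ → ContDiff ℝ ((⊤ : ℕ∞)
    : WithTop ℕ∞) θ → HasCompactSupport θ → (∀ s, 0 ≤ θ s ∧ θ s ≤ 1) → (∀ s, deriv θ s = ρ (-s) - ρ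
    s) → ∃ A : ℝ, ∀ lam : ℝ, 0 < lam → |2 * ∫ Y : EuclideanSpace ℝ (Fin 3), χ (Y 0) * χ (Y 1) * ρ (Y
    2) * ((W (lam • Y)) 2 * (W (lam • Y)) i)| ≤ lam⁻¹ * A + 4 * (C' ^ 2 + C') * ((∫ t, χ t) * ∫ s, θ
    s)) ∧ (∀ (κ : ℝ → ℝ) (ρ : ℝ → ℝ → ℝ) (Φ : EuclideanSpace ℝ (Fin 3) → ℝ), Continuous κ → (∀ t, 0
    ≤ κ t) → (∀ t, t ≤ 0 → κ t = 0) → (∀ t, 2 ≤ t → κ t = 0) → (∀ t, 0 ≤ t → t ≤ 1 → κ t + κ (t + 1)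
    = 1) → (∀ b : ℝ, 1 ≤ b → Continuous (ρ b) ∧ (∀ s, 0 ≤ ρ b s) ∧ (∀ s, ρ b s ≠ 0 → 1 < s ∧ s < 1 +
    b⁻¹) ∧ ∫ s, ρ b s = 1) → Continuous Φ → (∀ Y : EuclideanSpace ℝ (Fin 3), 1 ≤ Y 2 → Y 2 ≤ 2 → Φ
    (Y + EuclideanSpace.single 0 (1 : ℝ)) = Φ Y ∧ Φ (Y + EuclideanSpace.single 1 (1 : ℝ)) = Φ Y) →
    (∀ b : ℝ, 1 ≤ b → ∫ Y : EuclideanSpace ℝ (Fin 3), κ (Y 0) * κ (Y 1) * (ρ b (Y 2) * Φ Y) = 0) → ∫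
    q in Set.Icc (0 : ℝ) 1 ×ˢ Set.Icc (0 : ℝ) 1, Φ !₂[q.1, q.2, (1 : ℝ)] = 0) :=
  ⟨zeroStress_horiz_bound, zeroStress_scale_ineq, zeroStress_layer_limit⟩

end Summit.AnomalousDissipation.AnomalousDissipation.Theorems
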